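import Summits.BirchSwinnertonDyer.Rank1Residual.Additive.CongruentPartnerMainConjectureGordBSD
import Summits.BirchSwinnertonDyer.Rank1Residual.Additive.PalTwistPeriodHolds
import HarnessLib

/-!
# X4♯(G-ord), rank `0`, `p ≥ 5`: the cyclotomic-leading-term road with Delbourgo 1998 Prop. 4 SUPPLIED AT
# THE PAIR by Delbourgo 2002 Theorem (B) — `hDel98` (and the proved-away `hPal`) OUT of the `p ≥ 5`
# Gord class END of record, nothing added (cell `b2b-bsdres`, team n1011, ROW T-DEL98X-5, seat p10 GEN 10)

HONEST FRAMING (cell `b2b-bsdres`, run/shared/lean/b2b/bsd-rank1-residual/, verbatim in every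
file): the goal of the cell is to DELETE the COMBINATION-SHAPED residual classes of the
Birch–Swinnerton-Dyer formula for ALL analytic-rank `≤ 1` elliptic curves over `ℚ` — "full BSD
formula for every rank `≤ 1` curve in class `C`" assembled STRICTLY from published theorems — so
that the rank-`≤ 1` remainder becomes exactly the CONSTRUCTION-SHAPED classes, which are TYPED
(missing-input `Prop`s), NOT attempted. This is not "finishing BSD". Team n1011 (RESIDUAL-MAP §I N10:
X4♯(G-ord) at `p ≥ 5`): research route; TOOL + END-twin theorems only — no definition, no named fact,
no `sorry`; nothing booked; no residual-map mark / label / count moved; X4♯(G-ord) stays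
CONSTRUCTION-SHAPED. NOTHING of additive-p2's or p10 GEN 2's files is edited: §1 is a NEW declaration
whose proof body is additive-p2's `shaOrder_le_of_cycLeadingTerm` token for token except at the ONE line
[A]; everything else consumes the tree BY NAME.

## What and why

The `p ≥ 5` twin of FILES 2a/2b (`p = 3`). On X4♯(G-ord) ∩ `I₀*`, `p ≥ 5`, non-CM, rank `0`, the class
END of record `ClassX4Gord.bsdp_rankZero_of_katoHalf_of_coeffCert_of_budget_of_nonAnomalous`
(`CongruentPartnerMainConjectureGordBSD.lean:144`; route 2's END for the Gord_e2 W ≥ 1 rows @ ≥ 5,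
r2 GEN 43 2026-08-22T08:25Z (3)) displays BOTH `hDel98 : Delbourgo1998.prop4_rankZero_pow_dvd_constantCoeff`
(A75 — the UPPER half's control input, read through additive-p2's cyclotomic-leading-term core
`shaOrder_le_of_cycLeadingTerm`, ONE call at the cyclotomic-variable generator the core has chosen) AND
`hDel : Delbourgo2002.mainTheorem` (A175, Theorem (A)+(B) at `p ≥ 5` — the LOWER half's input), + the
Pal period fact A76 `hPal` (a theorem of the tree, `pal2012_…_holds`). As at `p = 3` (FILE 2b §1),
Theorem (B) in rank `0` IMPLIES A75's divisibility AT THE PAIR for the cyclotomic-variable generator: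

* §1 `shaOrder_le_of_cycLeadingTerm_of_shaDvdCyc` — additive-p2's class-agnostic cyc core
  (`#Ш_an = q`, `ord_p #Ш ≤ ord_p q + ord_p c_p`) with A75 replaced by the pointwise supplier `hdivCyc`
  asked ONLY at the cyclotomic-variable generator (the shape of FILE 2a); + `…missingUpperBoundAt…_of_five_le…`
  (`c_p ≤ 4 < p`), `ClassX4Gord.missingUpperBoundAt_rankZero_of_cycLeadingTerm_of_shaDvdCyc`,
  `ClassX4Gord.bsdp_rankZero_of_cycLeadingTerm_of_lower_of_shaDvdCyc`.
* §2 `TypeGOrd.shaDvdCycAt_of_delbourgo2002` / `ClassX4Gord.…` — the supplier from A175 at `p ≥ 5`,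
  non-CM (FILE 2b §1's proof with `mainTheorem_three ↦ mainTheorem`).
* §3 `ClassX4Gord.missingUpperBoundAt_rankZero_of_cycLeadingTerm_of_exactLeadingTerm`
  {A175, GZK, hmod + the typed `CycLeadingTermAt`}, `ClassX4Gord.bsdp_rankZero_of_cycLeadingTerm_of_cycLower_of_nonAnomalous_noDel98`
  (additive-p2's END: 4 ↦ 3 named), and the END-of-record twin
  **`ClassX4Gord.bsdp_rankZero_of_katoHalf_of_coeffCert_of_budget_of_nonAnomalous_noDel98`** with binder
  diff EXACTLY {`hDel98`, `hPal`} ↦ ∅, NOTHING added: named facts 7 ↦ 5 = {hK, hDel (A175), hGZK, hmod,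
  hmodD}; `hPal` — load-bearing at `p ≡ 1 (mod 4)` inside `cycLeadingTermAt_of_katoComponent` — is FED
  by its tree proof (hygiene: a proved-away fact), `hDel98` by §2 (D-2-shaped: pair (:144, A75), replacing
  fact A175 displayed on :144).

NOT claimed: no row closed (receivers stay conditional on `hcert`/`hbud`/`hna`); CM rows keep A75.

References: [Delbourgo2002] (A), (B) (p. 40), p. 39, p. 58; [Delbourgo1998] Prop. 4 (p. 144);
[Kato2004Asterisque] Thm. 17.4 (3); [Pal2012] Thm. 3.2; [MazurTateTeitelbaum1986Invent] §I.13; [Miller2011LMS].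
-/

noncomputable section

open scoped Classical MatrixGroups ModularForm NumberField

open CongruenceSubgroup WeierstrassCurve NumberField Literature.NumberTheory.EllipticCurves
  Literature.NumberTheory.EllipticCurves.ModularForms
  Literature.NumberTheory.EllipticCurves.Rank1Residual
  Literature.NumberTheory.EllipticCurves.Rank1Residual.Typed
  IsDedekindDomain Rat.HeightOneSpectrum

namespace Summit.BirchSwinnertonDyer.Rank1Residual.Additive

open AdditivePotMult

/-! ### §1 additive-p2's cyc core on the cyclotomic-generator supplier -/

section Core

variable (W : WeierstrassCurve ℚ) [W.IsElliptic] [W.IsGloballyMinimal] (p : ℕ) [hp : Fact p.Prime]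

/-- **Core (rank `0`) with the control input asked ONLY at the cyclotomic-variable generator.**
additive-p2's `shaOrder_le_of_cycLeadingTerm` token for token, except that its one use [A] of Delbourgo
1998 Prop. 4 is the pointwise supplier `hdivCyc` (FILE 2a's shape, extra premise
`IsCyclotomicVariable p γ` in hand): the typed `CycLeadingTermAt W p` + `hdivCyc` + GZK + modularity
give `#Ш_an(E) = q ∈ ℚ` with **`ord_p #Ш(E) ≤ ord_p q + ord_p c_p(E)`**; the additivity / (G)-or-(M) /
`p ≠ 2` binders of the original were used only through A75 and are DROPPED.
[cite: Delbourgo1998, Prop. 4 (p. 144) (shape of the abstracted input only)]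
[cite: MazurTateTeitelbaum1986Invent, §I.13 (the cyclotomic variable)] [cite: Miller2011LMS, Def. 1.1] -/
theorem shaOrder_le_of_cycLeadingTerm_of_shaDvdCyc
    (hdivCyc : ∀ (κ : ZpExtension ℚ p) (γ : Field.absoluteGaloisGroup ℚ), κ.IsCyclotomic →
      κ.IsTopGenerator γ → IsCyclotomicVariable p γ →
      ∀ D : W.SelmerDualData κ γ, Finite W.sha → Finite W.toAffine.Point →
      ∀ g ∈ D.charIdeal,
        (p : ℤ_[p]) ^ (padicValNat p (Nat.card (AddCommGroup.primaryComponent W.sha p)) +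
            padicValNat p (∏ᶠ v : HeightOneSpectrum (𝓞 ℚ),
              if (p : 𝓞 ℚ) ∈ v.asIdeal then 1 else W.tamagawaNumberAt v)) ∣
          PowerSeries.constantCoeff g * ((Nat.card W.toAffine.Point : ℕ) : ℤ_[p]) ^ 2)
    (hGZK : rank_eq_analyticRank_of_analyticRank_le_one) (hmod : hasEntireLFunction_rat)
    (hr : W.analyticRank = 0) (hLT : CycLeadingTermAt W p) :
    ∃ q : ℚ, shaAn W = (q : ℂ) ∧
      (padicValNat p W.shaOrder : ℤ) ≤
        padicValRat p q + padicValNat p (W.tamagawaNumberAt ((primesEquiv (R := 𝓞 ℚ)).symm ⟨p, hp.out⟩)) := by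
  classical
  have hpP : p.Prime := hp.out
  set v₀ : HeightOneSpectrum (𝓞 ℚ) := (primesEquiv (R := 𝓞 ℚ)).symm ⟨p, hp.out⟩ with hv₀
  -- rank 0: `L(E,1) ≠ 0`, `E(ℚ)` and `Ш` finite
  have hL : W.entireLFunction 1 ≠ 0 := (W.analyticRank_eq_zero_iff_holds (hmod W)).mp hr
  obtain ⟨hmw, hfin⟩ := hGZK W (by rw [hr]; exact zero_le_one)
  have hmw0 : W.mordellWeilRank = 0 := by rw [hmw, hr]
  haveI : Finite W.sha := hfin
  haveI hE : Finite W.toAffine.Point := W.finite_point_of_rank_zero hmw0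
  -- the cyclotomic setting and `X(E/ℚ_∞)`
  obtain ⟨κ, hκ, γ, hγ, hγ'⟩ := exists_isCyclotomic_isTopGenerator_isCyclotomicVariable_holds p
  obtain ⟨D⟩ := W.nonempty_selmerDualData_holds κ γ hγ
  -- the typed input: an element of the characteristic ideal with constant term `u · L(E,1)/Ω_E`
  obtain ⟨g, hgmem, u, q, hLq, hg0⟩ := hLT κ γ hκ hγ hγ' D
  -- [A]: the UPPER half of control at this pair (abstract supplier, asked at the cyclotomic-variable
  -- generator the core has just chosen)
  have hdvd := hdivCyc κ γ hκ hγ hγ' D hfin hE g hgmem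
  -- `#Ш_an = q · #E(ℚ)² / ∏ c_ℓ`
  have hΩ : (W.realPeriodRat : ℂ) ≠ 0 := by exact_mod_cast W.realPeriodRat_pos_holds.ne'
  have hq' : W.entireLFunction 1 / (W.realPeriodRat : ℂ) = (q : ℂ) := by
    rw [hLq, mul_div_cancel_right₀ _ hΩ]
  obtain ⟨-, -, -, hshaAn⟩ := Wuthrich2014.shaAn_eq_of_L_one_div_eq hGZK W hL hq'
  have hq0 : q ≠ 0 := by
    intro h0
    apply hL
    rw [hLq, h0, Rat.cast_zero, zero_mul]
  -- names for the arithmetic quantities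
  set T : ℕ := Nat.card W.toAffine.Point with hT
  set c : ℕ := W.tamagawaNumberAt v₀ with hc
  set P' : ℕ := ∏ᶠ v : HeightOneSpectrum (𝓞 ℚ),
    (if (p : 𝓞 ℚ) ∈ v.asIdeal then 1 else W.tamagawaNumberAt v) with hP'
  have hT0 : T ≠ 0 := by rw [hT]; exact Nat.card_pos.ne'
  have hPsplit : W.tamagawaProduct = c * P' := tamagawaProduct_eq_tamagawaNumberAt_mul_finprod W p
  have hPpos : 0 < W.tamagawaProduct := W.tamagawaProduct_pos_holds
  have hc0 : c ≠ 0 := fun h ↦ by rw [hPsplit, h, zero_mul] at hPpos; exact lt_irrefl 0 hPpos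
  have hP'0 : P' ≠ 0 := fun h ↦ by rw [hPsplit, h, mul_zero] at hPpos; exact lt_irrefl 0 hPpos
  have hvP : padicValNat p W.tamagawaProduct = padicValNat p c + padicValNat p P' := by
    rw [hPsplit, padicValNat.mul hc0 hP'0]
  have hsha : padicValNat p (Nat.card (AddCommGroup.primaryComponent W.sha p)) =
      padicValNat p W.shaOrder := by
    unfold WeierstrassCurve.shaOrder
    exact padicValNat_card_addPrimaryComponent p
  -- the divisibility in `ℤ_p`, read as an inequality of valuations in `ℚ_p`
  set g0 : ℚ_[p] := ((PowerSeries.constantCoeff g : ℤ_[p]) : ℚ_[p]) with hg0def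
  have hqQ : ((q : ℚ) : ℚ_[p]) ≠ 0 := by exact_mod_cast hq0
  have hg0ne : g0 ≠ 0 := by
    rw [hg0]
    exact mul_ne_zero (coe_units_ne_zero p u) hqQ
  have hvg0 : g0.valuation = padicValRat p q := by
    rw [hg0, Padic.valuation_mul (coe_units_ne_zero p u) hqQ, valuation_coe_units_eq_zero,
      zero_add, Padic.valuation_ratCast]
  have hTQ : ((T : ℕ) : ℚ_[p]) ≠ 0 := by exact_mod_cast hT0
  obtain ⟨c', hc'⟩ := hdvd
  have hkey : g0 * ((T : ℕ) : ℚ_[p]) ^ 2 =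
      (p : ℚ_[p]) ^ (padicValNat p (Nat.card (AddCommGroup.primaryComponent W.sha p)) +
        padicValNat p P') * ((c' : ℤ_[p]) : ℚ_[p]) := by
    have h := congrArg ((↑) : ℤ_[p] → ℚ_[p]) hc'
    push_cast at h
    rw [hg0def]
    exact h
  have hlhs0 : g0 * ((T : ℕ) : ℚ_[p]) ^ 2 ≠ 0 := mul_ne_zero hg0ne (pow_ne_zero 2 hTQ)
  have hc'0 : ((c' : ℤ_[p]) : ℚ_[p]) ≠ 0 := by
    intro h0
    rw [h0, mul_zero] at hkey
    exact hlhs0 hkey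
  have hpQ : (p : ℚ_[p]) ≠ 0 := by exact_mod_cast hpP.ne_zero
  have hval := congrArg Padic.valuation hkey
  rw [Padic.valuation_mul hg0ne (pow_ne_zero 2 hTQ), Padic.valuation_pow, Padic.valuation_natCast,
    hvg0, Padic.valuation_mul (pow_ne_zero _ hpQ) hc'0, Padic.valuation_pow, Padic.valuation_p,
    mul_one, hsha] at hval
  have hc'val : 0 ≤ (((c' : ℤ_[p]) : ℚ_[p])).valuation := PadicInt.valuation_coe_nonneg
  -- (**) `ord_p #Ш + ord_p P' ≤ ord_p q + 2 ord_p T`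
  have hineq : (padicValNat p W.shaOrder : ℤ) + padicValNat p P' ≤
      padicValRat p q + 2 * (padicValNat p T : ℤ) := by
    simp only [Nat.cast_add, Nat.cast_ofNat] at hval
    linarith
  -- conclusion: `ord_p #Ш ≤ ord_p(q T²/∏ c_ℓ) + ord_p c_p = ord_p q + 2 ord_p T − ord_p P'`
  refine ⟨q * (T : ℚ) ^ 2 / (W.tamagawaProduct : ℚ), ?_, ?_⟩
  · rw [hshaAn]
  · have hTq : (T : ℚ) ≠ 0 := by exact_mod_cast hT0
    have hPq : (W.tamagawaProduct : ℚ) ≠ 0 := by exact_mod_cast hPpos.ne'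
    rw [padicValRat.div (mul_ne_zero hq0 (pow_ne_zero 2 hTq)) hPq,
      padicValRat.mul hq0 (pow_ne_zero 2 hTq), padicValRat.pow, padicValRat.of_nat,
      padicValRat.of_nat, hvP]
    simp only [Nat.cast_ofNat, Nat.cast_add]
    linarith

/-- **The upper half from the cyclotomic leading term at every additive `p ≥ 5`, on the supplier**
(`c_p(E) ≤ 4 < p`: `padicValNat_tamagawaNumberAt_eq_zero_of_addv`). [cite: Delbourgo1998, Prop. 4 (p. 144) (shape only)]
[cite: Miller2011LMS, Def. 1.1] -/
theorem missingUpperBoundAt_of_cycLeadingTerm_of_five_le_of_shaDvdCyc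
    (hdivCyc : ∀ (κ : ZpExtension ℚ p) (γ : Field.absoluteGaloisGroup ℚ), κ.IsCyclotomic →
      κ.IsTopGenerator γ → IsCyclotomicVariable p γ →
      ∀ D : W.SelmerDualData κ γ, Finite W.sha → Finite W.toAffine.Point →
      ∀ g ∈ D.charIdeal,
        (p : ℤ_[p]) ^ (padicValNat p (Nat.card (AddCommGroup.primaryComponent W.sha p)) +
            padicValNat p (∏ᶠ v : HeightOneSpectrum (𝓞 ℚ),
              if (p : 𝓞 ℚ) ∈ v.asIdeal then 1 else W.tamagawaNumberAt v)) ∣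
          PowerSeries.constantCoeff g * ((Nat.card W.toAffine.Point : ℕ) : ℤ_[p]) ^ 2)
    (hGZK : rank_eq_analyticRank_of_analyticRank_le_one) (hmod : hasEntireLFunction_rat)
    (hp5 : 5 ≤ p) (hadd : Addv W p) (hr : W.analyticRank = 0) (hLT : CycLeadingTermAt W p) :
    MissingUpperBoundAt W p := by
  obtain ⟨q, hq, hle⟩ := shaOrder_le_of_cycLeadingTerm_of_shaDvdCyc W p hdivCyc hGZK hmod hr hLT
  refine ⟨q, hq, ?_⟩
  rw [padicValNat_tamagawaNumberAt_eq_zero_of_addv W p hadd hp5, Nat.cast_zero, add_zero] at hle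
  exact hle

end Core

section Gord

variable {W : WeierstrassCurve ℚ} [W.IsElliptic] [W.IsGloballyMinimal] {p : ℕ} [hp : Fact p.Prime]

/-- **X4♯(G-ord), `p ≥ 5`, `r_an = 0`, on the supplier: the UPPER half from the typed cyclotomic leading
term ALONE** — additive-p2's `ClassX4Gord.missingUpperBoundAt_rankZero_of_cycLeadingTerm` with
`hDel ↦ hdivCyc`. [cite: Delbourgo1998, Prop. 4 (p. 144) (shape only)] [cite: Miller2011LMS, Def. 1.1] -/
theorem ClassX4Gord.missingUpperBoundAt_rankZero_of_cycLeadingTerm_of_shaDvdCyc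
    (hdivCyc : ∀ (κ : ZpExtension ℚ p) (γ : Field.absoluteGaloisGroup ℚ), κ.IsCyclotomic →
      κ.IsTopGenerator γ → IsCyclotomicVariable p γ →
      ∀ D : W.SelmerDualData κ γ, Finite W.sha → Finite W.toAffine.Point →
      ∀ g ∈ D.charIdeal,
        (p : ℤ_[p]) ^ (padicValNat p (Nat.card (AddCommGroup.primaryComponent W.sha p)) +
            padicValNat p (∏ᶠ v : HeightOneSpectrum (𝓞 ℚ),
              if (p : 𝓞 ℚ) ∈ v.asIdeal then 1 else W.tamagawaNumberAt v)) ∣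
          PowerSeries.constantCoeff g * ((Nat.card W.toAffine.Point : ℕ) : ℤ_[p]) ^ 2)
    (hGZK : rank_eq_analyticRank_of_analyticRank_le_one) (hmod : hasEntireLFunction_rat)
    (hX : ClassX4Gord W p) (hp5 : 5 ≤ p) (hr : W.analyticRank = 0) (hLT : CycLeadingTermAt W p) :
    MissingUpperBoundAt W p :=
  missingUpperBoundAt_of_cycLeadingTerm_of_five_le_of_shaDvdCyc W p hdivCyc hGZK hmod hp5 hX.addv.2 hr
    hLT

/-- **X4♯(G-ord), `p ≥ 5`, `r_an = 0`, on the supplier: `BSD(E,p)` from the cyclotomic leading term and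
the LOWER half** — additive-p2's `ClassX4Gord.bsdp_rankZero_of_cycLeadingTerm_of_lower` with
`hDel ↦ hdivCyc`. [cite: Delbourgo1998, Prop. 4 (p. 144) (shape only)] [cite: Miller2011LMS, §1 and Def. 1.1] -/
theorem ClassX4Gord.bsdp_rankZero_of_cycLeadingTerm_of_lower_of_shaDvdCyc
    (hdivCyc : ∀ (κ : ZpExtension ℚ p) (γ : Field.absoluteGaloisGroup ℚ), κ.IsCyclotomic →
      κ.IsTopGenerator γ → IsCyclotomicVariable p γ →
      ∀ D : W.SelmerDualData κ γ, Finite W.sha → Finite W.toAffine.Point →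
      ∀ g ∈ D.charIdeal,
        (p : ℤ_[p]) ^ (padicValNat p (Nat.card (AddCommGroup.primaryComponent W.sha p)) +
            padicValNat p (∏ᶠ v : HeightOneSpectrum (𝓞 ℚ),
              if (p : 𝓞 ℚ) ∈ v.asIdeal then 1 else W.tamagawaNumberAt v)) ∣
          PowerSeries.constantCoeff g * ((Nat.card W.toAffine.Point : ℕ) : ℤ_[p]) ^ 2)
    (hGZK : rank_eq_analyticRank_of_analyticRank_le_one) (hmod : hasEntireLFunction_rat)
    (hX : ClassX4Gord W p) (hp5 : 5 ≤ p) (hr : W.analyticRank = 0) (hLT : CycLeadingTermAt W p)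
    (hlow : MissingLowerBoundAt W p) : BSDp W p :=
  bsdp_of_missingPPartAt W p hGZK (by rw [hr]; exact zero_le_one)
    (missingPPartAt_of_lower_of_upper W p hlow
      (ClassX4Gord.missingUpperBoundAt_rankZero_of_cycLeadingTerm_of_shaDvdCyc hdivCyc hGZK hmod hX hp5
        hr hLT))

/-! ### §2 Delbourgo 2002 (B) at `p ≥ 5` supplies Delbourgo 1998 Prop. 4 AT THE PAIR -/

/-- **Delbourgo 2002 (A)+(B) at `p ≥ 5` ⟹ A75's divisibility AT THE PAIR, for the cyclotomic-variable
generator**, on an additive (G)-ordinary non-CM pair — the `p ≥ 5` twin of FILE 2b's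
`TypeGOrd.shaDvdCycAt_three_of_delbourgo2002` (same proof: `char = (fE)` by `charIdeal_isPrincipal_holds`,
`X` torsion by (A) and finitely generated by `SelmerDualData.module_finite_of_isCyclotomic`, Theorem (B)
in rank `0` by `LeadingTermClauses.constantCoeff` — `fE(0) · #E(ℚ)_{tors}² = u · ℓ · #Ш[p^∞] · ∏ c_v`
with `ℓ ∣ p²` —, `#E(ℚ) = #E(ℚ)_{tors}`, `∏ c_v = c_p · ∏ᶠ_{v∤p} c_v`, `p ^ ord_p n ∣ n`, `g = h · fE`).
[cite: Delbourgo2002, Theorem (A), (B) (p. 40), Hypothesis (p. 39), p. 58]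
[cite: Delbourgo1998, Prop. 4 (p. 144) (the supplied statement)] -/
theorem TypeGOrd.shaDvdCycAt_of_delbourgo2002 (hDelA : Delbourgo2002.mainTheorem) (hG : TypeGOrd W p)
    (hadd : Addv W p) (hcm : ¬ W.HasCM) (hp5 : 5 ≤ p) :
    ∀ (κ : ZpExtension ℚ p) (γ : Field.absoluteGaloisGroup ℚ), κ.IsCyclotomic →
      κ.IsTopGenerator γ → IsCyclotomicVariable p γ →
      ∀ D : W.SelmerDualData κ γ, Finite W.sha → Finite W.toAffine.Point →
      ∀ g ∈ D.charIdeal,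
        (p : ℤ_[p]) ^ (padicValNat p (Nat.card (AddCommGroup.primaryComponent W.sha p)) +
            padicValNat p (∏ᶠ v : HeightOneSpectrum (𝓞 ℚ),
              if (p : 𝓞 ℚ) ∈ v.asIdeal then 1 else W.tamagawaNumberAt v)) ∣
          PowerSeries.constantCoeff g * ((Nat.card W.toAffine.Point : ℕ) : ℤ_[p]) ^ 2 := by
  intro κ γ hκ hγ hγ' D hfin hE g hg
  obtain ⟨hA, Dh, hB⟩ := hDelA W p hp5 hcm hadd hG
  haveI : Finite W.sha := hfin
  haveI : Finite W.toAffine.Point := hE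
  have hfinp : Finite (AddCommGroup.primaryComponent W.sha p) :=
    Finite.of_injective _ Subtype.val_injective
  haveI : Module.Finite (IwasawaAlgebra p) D.X :=
    SelmerDualData.module_finite_of_isCyclotomic (W := W) (κ := κ) hκ D hγ
  haveI : (Module.charIdeal (IwasawaAlgebra p) D.X).IsPrincipal := charIdeal_isPrincipal_holds p D.X
  obtain ⟨fE, hfE⟩ := Submodule.IsPrincipal.principal (Module.charIdeal (IwasawaAlgebra p) D.X)
  obtain ⟨-, u, ℓ, -, -, heq⟩ := hB.constantCoeff hκ hγ hγ' D (hA κ γ hκ hγ D) hfE hfinp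
  -- names
  set S : ℕ := Nat.card (AddCommGroup.primaryComponent W.sha p) with hS
  set T : ℕ := Nat.card W.toAffine.Point with hT
  set c : ℕ := W.tamagawaNumberAt ((primesEquiv (R := 𝓞 ℚ)).symm ⟨p, hp.out⟩) with hc
  set P' : ℕ := ∏ᶠ v : HeightOneSpectrum (𝓞 ℚ),
    (if (p : 𝓞 ℚ) ∈ v.asIdeal then 1 else W.tamagawaNumberAt v) with hP'
  have hTtors : W.torsionOrder = T := (W.natCard_point_eq_torsionOrder).symm
  have hPsplit : W.tamagawaProduct = c * P' := tamagawaProduct_eq_tamagawaNumberAt_mul_finprod W p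
  -- the exact leading term, pulled back to `ℤ_p`
  have heqZ : (PowerSeries.constantCoeff fE : ℤ_[p]) * ((T : ℕ) : ℤ_[p]) ^ 2 =
      (u : ℤ_[p]) * (ℓ : ℤ_[p]) * ((S : ℤ_[p]) * ((c : ℤ_[p]) * (P' : ℤ_[p]))) := by
    have h : (((PowerSeries.constantCoeff fE : ℤ_[p]) * ((T : ℕ) : ℤ_[p]) ^ 2 : ℤ_[p]) : ℚ_[p]) =
        (((u : ℤ_[p]) * (ℓ : ℤ_[p]) * ((S : ℤ_[p]) * ((c : ℤ_[p]) * (P' : ℤ_[p]))) : ℤ_[p]) :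
          ℚ_[p]) := by
      push_cast
      rw [hTtors, hPsplit] at heq
      push_cast at heq
      exact heq
    exact PadicInt.ext h
  -- `g = h · fE`
  have hgmem : g ∈ Ideal.span {fE} := by
    change g ∈ Module.charIdeal (IwasawaAlgebra p) D.X at hg
    rw [hfE] at hg
    exact hg
  rw [Ideal.mem_span_singleton'] at hgmem
  obtain ⟨h, rfl⟩ := hgmem
  -- `p ^ ord_p S ∣ S`, `p ^ ord_p P' ∣ P'`
  have hSd : (p : ℤ_[p]) ^ padicValNat p S ∣ (S : ℤ_[p]) := by
    have := Nat.cast_dvd_cast (α := ℤ_[p]) (pow_padicValNat_dvd (p := p) (n := S))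
    simpa only [Nat.cast_pow] using this
  have hPd : (p : ℤ_[p]) ^ padicValNat p P' ∣ (P' : ℤ_[p]) := by
    have := Nat.cast_dvd_cast (α := ℤ_[p]) (pow_padicValNat_dvd (p := p) (n := P'))
    simpa only [Nat.cast_pow] using this
  have hkey : (p : ℤ_[p]) ^ (padicValNat p S + padicValNat p P') ∣
      (u : ℤ_[p]) * (ℓ : ℤ_[p]) * ((S : ℤ_[p]) * ((c : ℤ_[p]) * (P' : ℤ_[p]))) := by
    rw [pow_add]
    exact Dvd.dvd.mul_left (mul_dvd_mul hSd (Dvd.dvd.mul_left hPd _)) _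
  rw [map_mul, mul_assoc, heqZ]
  exact Dvd.dvd.mul_left hkey _

/-- **X4♯(G-ord), `p ≥ 5`, non-CM: the supplier** (`ClassX4Gord` form).
[cite: Delbourgo2002, Theorem (A), (B) (p. 40)] -/
theorem ClassX4Gord.shaDvdCycAt_of_delbourgo2002 (hDelA : Delbourgo2002.mainTheorem)
    (hX : ClassX4Gord W p) (hcm : ¬ W.HasCM) (hp5 : 5 ≤ p) :
    ∀ (κ : ZpExtension ℚ p) (γ : Field.absoluteGaloisGroup ℚ), κ.IsCyclotomic →
      κ.IsTopGenerator γ → IsCyclotomicVariable p γ →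
      ∀ D : W.SelmerDualData κ γ, Finite W.sha → Finite W.toAffine.Point →
      ∀ g ∈ D.charIdeal,
        (p : ℤ_[p]) ^ (padicValNat p (Nat.card (AddCommGroup.primaryComponent W.sha p)) +
            padicValNat p (∏ᶠ v : HeightOneSpectrum (𝓞 ℚ),
              if (p : 𝓞 ℚ) ∈ v.asIdeal then 1 else W.tamagawaNumberAt v)) ∣
          PowerSeries.constantCoeff g * ((Nat.card W.toAffine.Point : ℕ) : ℤ_[p]) ^ 2 :=
  hX.typeGOrd.shaDvdCycAt_of_delbourgo2002 hDelA hX.addv.2 hcm hp5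

/-! ### §3 The `p ≥ 5` Gord ENDs with `hDel98` (and `hPal`) OUT, nothing added -/

/-- **X4♯(G-ord), `p ≥ 5`, `r_an = 0`, non-CM: the UPPER half from the typed cyclotomic leading term,
Delbourgo 2002 (A)+(B), GZK and modularity** — additive-p2's
`ClassX4Gord.missingUpperBoundAt_rankZero_of_cycLeadingTerm` with `{hDel} ↦ {hDelA, hcm}`.
[cite: Delbourgo2002, Theorem (A), (B) (p. 40)] [cite: Miller2011LMS, Def. 1.1] -/
theorem ClassX4Gord.missingUpperBoundAt_rankZero_of_cycLeadingTerm_of_exactLeadingTerm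
    (hDelA : Delbourgo2002.mainTheorem)
    (hGZK : rank_eq_analyticRank_of_analyticRank_le_one) (hmod : hasEntireLFunction_rat)
    (hX : ClassX4Gord W p) (hcm : ¬ W.HasCM) (hp5 : 5 ≤ p) (hr : W.analyticRank = 0)
    (hLT : CycLeadingTermAt W p) : MissingUpperBoundAt W p :=
  ClassX4Gord.missingUpperBoundAt_rankZero_of_cycLeadingTerm_of_shaDvdCyc
    (hX.shaDvdCycAt_of_delbourgo2002 hDelA hcm hp5) hGZK hmod hX hp5 hr hLT

/-- **END TWIN — X4♯(G-ord), ANY defect covered by the cyc road, `p ≥ 5`, `r_an = 0`, non-CM,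
non-anomalous: `BSD(E,p)` ⟸ the cyclotomic leading term + the LOWER divisibility at `T = 0`**,
additive-p2's `ClassX4Gord.bsdp_rankZero_of_cycLeadingTerm_of_cycLower_of_nonAnomalous` with binder diff
EXACTLY {`hDel98`} ↦ ∅, NOTHING added (named facts {hDel98, hDel, hGZK, hmod} 4 ↦ 3).
[cite: Delbourgo2002, Theorem (A), (B) (p. 40)] [cite: Miller2011LMS, §1 and Def. 1.1] -/
theorem ClassX4Gord.bsdp_rankZero_of_cycLeadingTerm_of_cycLower_of_nonAnomalous_noDel98
    (hDel : Delbourgo2002.mainTheorem)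
    (hGZK : rank_eq_analyticRank_of_analyticRank_le_one) (hmod : hasEntireLFunction_rat)
    (hX : ClassX4Gord W p) (hcm : ¬ W.HasCM) (hp5 : 5 ≤ p) (hr : W.analyticRank = 0)
    (hLT : CycLeadingTermAt W p) (hLow : CycLowerLeadingTermAt W p)
    (hna : Delbourgo2002.ReductionNonAnomalous W p) : BSDp W p :=
  ClassX4Gord.bsdp_rankZero_of_cycLeadingTerm_of_lower_of_shaDvdCyc
    (hX.shaDvdCycAt_of_delbourgo2002 hDel hcm hp5) hGZK hmod hX hp5 hr hLT
    (ClassX4Gord.missingLowerBoundAt_rankZero_of_cycLower_of_nonAnomalous hDel hGZK hmod hX hcm hp5 hr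
      hLow hna)

/-- **END TWIN — ROUTE 2's Gord_e2 END at `p ≥ 5`: X4♯(G-ord) ∩ `I₀*` ∩ {`ρ̄` onto}, `p ≥ 5`,
`r_an = 0`, non-CM, non-anomalous: `BSD(E,p)` ⟸ ONE unit coefficient at index `b` + the budget
`BudgetLeLambdaAt p W b`**, p10 GEN 2's
`ClassX4Gord.bsdp_rankZero_of_katoHalf_of_coeffCert_of_budget_of_nonAnomalous`
(`Additive/CongruentPartnerMainConjectureGordBSD.lean:144`) with binder diff EXACTLY {`hDel98`, `hPal`} ↦ ∅,
NOTHING added: named facts 7 ↦ 5 = {hK (Kato half-eigen A136), hDel (Delbourgo 2002 A175), hGZK, hmod,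
hmodD}; typed hX hcm hp5 he hsurj hr hcert hbud hna UNCHANGED; `hPal` (load-bearing at `p ≡ 1 (mod 4)`
inside `cycLeadingTermAt_of_katoComponent` / the lower bridge) FED by its tree proof
`pal2012_thm32_sqrt_mul_realPeriodRat_twist_eq_of_prime_one_mod_four_holds`.
[cite: Delbourgo2002, Theorem (A), (B) (p. 40)] [cite: Kato2004Asterisque, Thm. 17.4 (3) (p. 273)]
[cite: Pal2012, Thm. 3.2] [cite: Miller2011LMS, §1 and Def. 1.1] -/
theorem ClassX4Gord.bsdp_rankZero_of_katoHalf_of_coeffCert_of_budget_of_nonAnomalous_noDel98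
    (hK : Wuthrich2014.kato_halfEigenCharIdeal_dvd_cyclotomicPrime_of_surjective)
    (hDel : Delbourgo2002.mainTheorem)
    (hGZK : rank_eq_analyticRank_of_analyticRank_le_one) (hmod : hasEntireLFunction_rat)
    (hmodD : nonempty_modularParametrizationData)
    (hX : ClassX4Gord W p) (hcm : ¬ W.HasCM) (hp5 : 5 ≤ p) (he : semistabilityIndex W p = 2)
    (hsurj : Surj W p) (hr : W.analyticRank = 0)
    {b : ℕ} (hcert : BranchUnitCoeffAt W p b) (hbud : BudgetLeLambdaAt p W b)
    (hna : Delbourgo2002.ReductionNonAnomalous W p) : BSDp W p :=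
  ClassX4Gord.bsdp_rankZero_of_cycLeadingTerm_of_cycLower_of_nonAnomalous_noDel98 hDel hGZK hmod hX hcm
    hp5 hr
    (ClassX4Gord.cycLeadingTermAt_of_katoComponent W p
      (Kato2004.charIdeal_dvd_padicLFunctionBranch_component_of_surjective_of_half hK)
      pal2012_thm32_sqrt_mul_realPeriodRat_twist_eq_of_prime_one_mod_four_holds hmod hmodD hX hp5 he
      hsurj)
    (hX.cycLowerLeadingTermAt_of_katoHalf_of_coeffCert_of_budget hK
      pal2012_thm32_sqrt_mul_realPeriodRat_twist_eq_of_prime_one_mod_four_holds hmod hmodD he hsurj hcert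
      hbud)
    hna

end Gord

end Summit.BirchSwinnertonDyer.Rank1Residual.Additive

end
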